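import Literature.NumberTheory.GaloisCohomology.Howard2004.TauEigencocycleLocalizationProofs
import Literature.NumberTheory.GaloisCohomology.Howard2004.ResidualShaTwoVanishingProofs
import HarnessLib

/-!
# Howard 2004 on a `DVRSetting`: `Ш¹(K, T̄) = 0` from H.2 and Čebotarev ALONE (no `p ≠ 0 in R`, no `𝓛_s ⊂ 𝓛`),
# hence `Ш²(K, T^{(0)}) = 0` — proofs file (brick «C451-CL Q0 SHA», the sharpening asked for on the cell board)

Topic `NumberTheory/GaloisCohomology/Howard2004`. THEOREMS ONLY: no definition, no named fact, no instance, no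
notation, no `sorry`.  Cell `pub/bsd-print-x9` (seat `bsd-line-x10b-p1` LEAD g14, `--supports stmt-BirchSwinnertonDyer-22642`).
Companion of `ResidualShaOneVanishingProofs` (x10b-p1-w8 g12: `DVRSetting.sha_rhobar_eq_bot (hC) (hp0) (hL)`, through the
ENGINE's Lemma 1.6.2 wrapper at the primes of `𝓛`, hence its extra letters `hp0 : (p : R) ≠ 0`, `hL : S.LargePrimes`) and of
`ResidualShaTwoVanishingProofs` (the H.4 transport `Ш¹(K, T̄) = 0 ⟹ Ш²(K, T^{(0)}) = 0`).  HERE the vanishing of `Ш¹(K, T̄)`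
is proved from H.1 (finiteness), H.2 and Čebotarev ONLY — the form needed to prove the typed leaf C45.1″
`prop141_casselsTate_skewPairing_atLevel_printIntended`, whose binders carry no `LargePrimes` letter.

* §1 (generic, any finite discrete `Γ_K`-module `M` over a number field): a cocycle of a class of `Ш¹(K, M)` VANISHES at
  every `g ∈ Γ_K` acting trivially on `M` (`apply_eq_zero_of_oneCocycleClass_mem_sha`) — if `φ(g) ≠ 0`, the open subgroup
  `U = {ρ = 1, φ = 0}` contains almost all inertia groups (`exists_finite_forall_inertia_le_of_isOpen`), Frobenius density
  (`absoluteGaloisGroup.frobenius_dense`, from `Automorphic.chebotarev_artinRep`) puts an arithmetic Frobenius `γ` in the coset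
  `g·U` at an unramified place `w`, `γ` acts trivially with `φ(γ) = φ(g) ≠ 0`, and the evaluation criterion
  `localization_oneCocycleClass_eq_zero_iff` gives `loc_w [φ] ≠ 0`; hence **`Ш¹(K, M) = 0` whenever restriction to SOME
  subgroup acting trivially kills no non-zero class** (`sha_eq_bot_of_forall_resSubgroup_eq_zero`);
* §2 (Howard): H.2 supplies that subgroup (`Γ_F ∩ Γ_{K(μ_{p^∞})}`, acting trivially on `T̄` through H.1's presentation):
  **`DVRSetting.sha_rhobar_eq_bot_of_chebotarev (S hy hC) : sha S.ρbar = ⊥`**, and with w8's transport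
  **`DVRSetting.shaTwo_level_zero_eq_bot (S hy hC hST he0) : shaTwo (S.T.ρ 0) = ⊥`** (`e₀ = 1`; `hST` = Poitou–Tate duality
  (b) `poitouTate_sha_tateDual K`, a kernel theorem Summits-side) — the obstruction group of the class-level port of Prop. 1.4.1.

HONEST FRAMING: Prop. 1.4.1, Thm. 1.4.2, C45.1′/C45.1″ and `thm161_dvrKolyvaginBound` are NOT proved here; no summit statement
is proved; the Birch–Swinnerton-Dyer conjecture is not proved by any of this.  Inputs taken as hypotheses: Čebotarev
(`Automorphic.chebotarev_artinRep`, PROVED in the tree: `chebotarev_artinRep_holds`) and `poitouTate_sha_tateDual` (proved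
Summits-side).

References: [Howard2004HeegnerKolyvagin] B. Howard, Compositio Math. **140** (2004) = arXiv:1202.6340, §1.3 H.1/H.2 (p. 7
L59–63), Lemma 1.6.2 (p. 11 L36–40, L55–58), Prop. 1.4.1 (p0008 L83–98); [MilneADT2006] Ch. I §4, Thm. 4.10 (a);
[SerreGaloisCohomology1997] I §2.2, §5.1, II §6.1; [TateGCFT1967] §2.4 (Tchebotarev density theorem).
-/

set_option autoImplicit false

noncomputable section

open scoped Classical Pointwise
open Function NumberField IsDedekindDomain Field

namespace Literature.NumberTheory.GaloisCohomology.Howard2004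

open Literature.NumberTheory.GaloisRepresentations
open Literature.NumberTheory.GaloisRepresentations.DiscreteGaloisModule

/-! ## §1 Generic: `Ш¹` of a finite module dies on the elements acting trivially (Čebotarev) -/

section Generic

variable {K : Type} [Field K] {M : Type} [AddCommGroup M] [TopologicalSpace M]
  [DiscreteTopology M]

/-- **A cocycle representing a class of `Ш¹(K, M)` (`M` finite) vanishes at every `g ∈ Γ_K` acting trivially on
`M`.**  If `φ(g) ≠ 0`, the open subgroup `U = {u | ρ(u) = 1, φ(u) = 0}` contains the inertia groups above almost
all places (`exists_finite_forall_inertia_le_of_isOpen`); by Frobenius density (Čebotarev) some `γ ∈ g·U` is an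
arithmetic Frobenius at a prime `𝔓 ∣ w` with `w` outside that finite set; `γ` acts trivially and
`φ(γ) = φ(g) + g·φ(u) = φ(g) ≠ 0`, so `loc_w [φ] ≠ 0` by the evaluation criterion — contradicting `[φ] ∈ Ш¹`.
[cite: Howard2004HeegnerKolyvagin, Lemma 1.6.2 proof (arXiv:1202.6340 p. 11 L51–58: «By the Cebotarev theorem … evaluation at the Frobenius»)]
[cite: TateGCFT1967, §2.4 (Tchebotarev density theorem)] -/
theorem apply_eq_zero_of_oneCocycleClass_mem_sha [NumberField K] [Finite M] (hC : Automorphic.chebotarev_artinRep)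
    (ρ : DiscreteGaloisModule K M) (φ : contOneCocycles ρ.toTopRep)
    (hφ : oneCocycleClass ρ.toTopRep φ ∈ sha ρ) {g : absoluteGaloisGroup K} (hg : ∀ m, ρ g m = m) :
    φ.1 g = 0 := by
  by_contra hne
  -- the open subgroup `U = {u | u acts trivially and φ u = 0}`
  let U : Subgroup (absoluteGaloisGroup K) :=
    { carrier := {u | (∀ m, ρ u m = m) ∧ φ.1 u = 0}
      mul_mem' := fun {a b} ha hb ↦ ⟨fun m ↦ by rw [map_mul, Module.End.mul_apply, hb.1, ha.1],
        by rw [apply_mul_eq_add_of_apply_eq_self ρ φ ha.1, ha.2, hb.2, add_zero]⟩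
      one_mem' := ⟨fun m ↦ by rw [map_one, Module.End.one_apply], contOneCocycles.apply_one φ⟩
      inv_mem' := fun {a} ha ↦ by
        have hinv : ∀ m, ρ a⁻¹ m = m := fun m ↦ by
          conv_lhs => rw [← ha.1 m]
          rw [← Module.End.mul_apply, ← map_mul, inv_mul_cancel, map_one, Module.End.one_apply]
        refine ⟨hinv, ?_⟩
        have h := φ.2 a a⁻¹
        rw [mul_inv_cancel, contOneCocycles.apply_one, ha.2, zero_add] at h
        have h' : ρ a (φ.1 a⁻¹) = 0 := h.symm
        have h'' := congrArg (ρ a⁻¹) h'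
        rwa [← Module.End.mul_apply, ← map_mul, inv_mul_cancel, map_one, Module.End.one_apply,
          map_zero] at h'' }
  have hUopen : IsOpen (U : Set (absoluteGaloisGroup K)) := by
    have h1 : IsOpen {u : absoluteGaloisGroup K | ∀ m, ρ u m = m} := by
      rw [Set.setOf_forall]
      exact isOpen_iInter_of_finite fun m ↦ ρ.isOpen_setOf_apply_eq m
    have h2 : IsOpen {u : absoluteGaloisGroup K | φ.1 u = 0} :=
      (isOpen_discrete {(0 : M)}).preimage φ.1.continuous
    exact h1.inter h2
  -- almost all inertia groups lie in `U`
  obtain ⟨T, hTfin, hTI⟩ := exists_finite_forall_inertia_le_of_isOpen hUopen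
  -- a Frobenius in the open coset `g · U`
  set O : Set (absoluteGaloisGroup K) := (fun u ↦ g * u) '' (U : Set (absoluteGaloisGroup K)) with hO
  have hOopen : IsOpen O := (Homeomorph.mulLeft g).isOpenMap _ hUopen
  have hOne : O.Nonempty := ⟨g * 1, ⟨1, U.one_mem, rfl⟩⟩
  obtain ⟨γ, hγO, w, hwT, 𝔓, h𝔓, hγ⟩ :=
    (absoluteGaloisGroup.frobenius_dense hC K T hTfin).inter_open_nonempty O hOopen hOne
  obtain ⟨u, hu, rfl⟩ := hγO
  have huU : (∀ m, ρ u m = m) ∧ φ.1 u = 0 := hu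
  have hγρ : ∀ m, ρ (g * u) m = m := fun m ↦ by rw [map_mul, Module.End.mul_apply, huU.1, hg]
  have hγφ : φ.1 (g * u) = φ.1 g := by
    rw [apply_mul_eq_add_of_apply_eq_self ρ φ hg, huU.2, add_zero]
  have hI : ∀ i ∈ 𝔓.inertia (absoluteGaloisGroup K), ∀ m, ρ i m = m :=
    fun i hi ↦ (hTI w hwT 𝔓 h𝔓 hi).1
  have hφI : ∀ i ∈ 𝔓.inertia (absoluteGaloisGroup K), φ.1 i = 0 :=
    fun i hi ↦ (hTI w hwT 𝔓 h𝔓 hi).2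
  have hloc : galoisCohomology.localization ρ (Sum.inr w) 1 (oneCocycleClass ρ.toTopRep φ) = 0 :=
    (mem_sha_iff ρ _).1 hφ (Sum.inr w)
  have h0 := (localization_oneCocycleClass_eq_zero_iff ρ φ h𝔓 hγ hγρ hI hφI).1 hloc
  rw [hγφ] at h0
  exact hne h0

/-- **`Ш¹(K, M) = 0` from an injective restriction** (`M` finite): if the restriction
`H¹(Γ_K, M) → H¹(Λ, M)` to a subgroup `Λ` acting trivially on `M` kills no non-zero class (Howard's H.2 supplies
this with `Λ = Γ_{F(μ_{p^∞})}`), then `Ш¹(K, M) = 0`: a cocycle of a class of `Ш¹` vanishes on `Λ` (§1), so its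
restriction to `Λ` is principal (indeed zero). [cite: Howard2004HeegnerKolyvagin, §1.3 H.2 and Lemma 1.6.2 (arXiv:1202.6340 p. 7 L61–63, p. 11 L36–40)]
[cite: MilneADT2006, Ch. I §4 (`Ш¹_S(K, M)`)] -/
theorem sha_eq_bot_of_forall_resSubgroup_eq_zero [NumberField K] [Finite M] (hC : Automorphic.chebotarev_artinRep)
    (ρ : DiscreteGaloisModule K M) (Λ : Subgroup (absoluteGaloisGroup K)) (hΛ : ∀ g ∈ Λ, ∀ m, ρ g m = m)
    (hinj : ∀ c : galoisCohomology ρ 1, resSubgroup ρ.toTopRep Λ 1 c = 0 → c = 0) :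
    sha ρ = ⊥ := by
  rw [eq_bot_iff]
  intro c hc
  rw [AddSubgroup.mem_bot]
  obtain ⟨φ, rfl⟩ := oneCocycleClass_surjective ρ.toTopRep c
  refine hinj _ ((resSubgroup_oneCocycleClass_eq_zero_iff ρ.toTopRep Λ φ).2 ⟨0, fun h hh ↦ ?_⟩)
  rw [map_zero, sub_zero]
  exact apply_eq_zero_of_oneCocycleClass_mem_sha hC ρ φ hc (hΛ h hh)


end Generic

/-! ## §2 Howard's `DVRSetting`: `Ш¹(K, T̄) = 0` (H.2 + Čebotarev only) and `Ш²(K, T^{(0)}) = 0` -/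

namespace DVRSetting

variable {p : ℕ} [Fact p.Prime] {K : Type} [Field K] [NumberField K]
  {R : Type} [CommRing R] [IsDomain R] [IsDiscreteValuationRing R] [Algebra ℤ_[p] R]
  {N : ℕ → Type} [∀ k, AddCommGroup (N k)] [∀ k, TopologicalSpace (N k)]
  [∀ k, DiscreteTopology (N k)] [∀ k, Module R (N k)]
  {Rk : ℕ → Type} [∀ k, CommRing (Rk k)] [∀ k, IsLocalRing (Rk k)] [∀ k, TopologicalSpace (Rk k)]
  [∀ k, DiscreteTopology (Rk k)] [∀ k, Algebra ℤ_[p] (Rk k)] [∀ k, Algebra R (Rk k)]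
  [∀ k, Module (Rk k) (N k)] [∀ k, IsScalarTower R (Rk k) (N k)]
  {Nbar : Type} [AddCommGroup Nbar] [TopologicalSpace Nbar] [DiscreteTopology Nbar]
  [∀ k, Module (Rk k) Nbar]
  {Nq : ℕ → Finset (HeightOneSpectrum (𝓞 K)) → Type} [∀ k n, AddCommGroup (Nq k n)]
  [∀ k n, TopologicalSpace (Nq k n)] [∀ k n, DiscreteTopology (Nq k n)]
  [∀ k n, Module (Rk k) (Nq k n)] [∀ k n, Module R (Nq k n)]
  [∀ k n, IsScalarTower R (Rk k) (Nq k n)]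

/-- **H.2 packaged: a subgroup `Λ = Γ_F ∩ Γ_{K(μ_{p^∞})}` acting trivially on `T̄` (through H.1's presentation
`π̄₀ : T^{(0)} ↠ T̄`) on which restriction `H¹(K, T̄) → H¹(Λ, T̄)` kills no non-zero class.**
[cite: Howard2004HeegnerKolyvagin, §1.3 H.1/H.2 (arXiv:1202.6340 p. 7 L59–63)] -/
theorem exists_trivial_resSubgroup_residual (S : DVRSetting p K R N Rk Nbar Nq) (hy : S.SatisfiesH) :
    ∃ Λ : Subgroup (absoluteGaloisGroup K), (∀ g ∈ Λ, ∀ m : Nbar, S.ρbar g m = m) ∧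
      ∀ c : galoisCohomology S.ρbar 1, resSubgroup S.ρbar.toTopRep Λ 1 c = 0 → c = 0 := by
  obtain ⟨ΓF, -, -, -, htriv, hinj⟩ := hy.h2
  refine ⟨ΓF ⊓ ⨅ n : ℕ, (DiscreteGaloisModule.mu K (p ^ n)).ker, ?_, fun c hc ↦ hinj c hc⟩
  rintro g ⟨hg₁, -⟩ m
  obtain ⟨x, rfl⟩ := (hy.h1 0).1.surjective m
  rw [← (hy.h1 0).1.equivariant, htriv 0 g hg₁ x]

/-- **`Ш¹(K, T̄) = 0` on a `DVRSetting` with H.0–H.5, from H.2 and Čebotarev ALONE** (no `(p : R) ≠ 0`, no `LargePrimes`;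
compare `sha_rhobar_eq_bot`): a class of `Ш¹(K, T̄)` dies on `Γ_F ∩ Γ_{K(μ_{p^∞})}` by §1, hence is `0` by H.2.
[cite: Howard2004HeegnerKolyvagin, §1.3 H.2 and Lemma 1.6.2 (arXiv:1202.6340 p. 7 L61–63, p. 11 L36–40)] [cite: MilneADT2006, Ch. I §4] -/
theorem sha_rhobar_eq_bot_of_chebotarev (S : DVRSetting p K R N Rk Nbar Nq) (hy : S.SatisfiesH)
    (hC : Automorphic.chebotarev_artinRep) : sha S.ρbar = ⊥ := by
  haveI : Finite (N 0) := S.finite_level hy 0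
  haveI : Finite Nbar := Finite.of_surjective _ (hy.h1 0).1.surjective
  obtain ⟨Λ, hΛ, hinj⟩ := S.exists_trivial_resSubgroup_residual hy
  exact sha_eq_bot_of_forall_resSubgroup_eq_zero hC S.ρbar Λ hΛ hinj

/-- **`Ш²(K, T^{(0)}) = 0` at the bottom of a FULL tower (`e₀ = 1`), from H.0–H.5, Čebotarev and Poitou–Tate duality (b)
ALONE** — the obstruction group of the class-level port of Prop. 1.4.1 (every `𝓕(n)`-Selmer class of `T^{(t)}` lifts to
`H¹(K, T^{(t+1)})`): §2's `Ш¹(K, T̄) = 0` fed to x10b-p1-w8's H.4-transport `shaTwo_level_zero_eq_bot_of_sha_rhobar`.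
[cite: Howard2004HeegnerKolyvagin, §1.3 H.2/H.4 and Prop. 1.4.1 (arXiv:1202.6340 p. 7 L61–82, p0008 L83–98)] [cite: MilneADT2006, Ch. I, Thm. 4.10 (a)] -/
theorem shaTwo_level_zero_eq_bot (S : DVRSetting p K R N Rk Nbar Nq) (hy : S.SatisfiesH)
    (hC : Automorphic.chebotarev_artinRep) (hST : poitouTate_sha_tateDual K) (he0 : S.e 0 = 1) :
    shaTwo (S.T.ρ 0) = ⊥ := by
  haveI : ∀ k, Finite (N k) := fun k ↦ S.finite_level hy k
  exact S.shaTwo_level_zero_eq_bot_of_sha_rhobar hy he0 hST (S.sha_rhobar_eq_bot_of_chebotarev hy hC)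

end DVRSetting

end Literature.NumberTheory.GaloisCohomology.Howard2004

end
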